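import Summits.AtomisticToContinuum.Crystallization.Theorems.FrustratedLawDichotomyAtlasReachTransport
import Summits.AtomisticToContinuum.Crystallization.Theorems.FrustratedLawDichotomyCellF1cCert

/-!
# FrustratedLawDichotomy · crux `AperiodicFrustratedLawGap` (stmt-AtomisticToContinuum-27623) — the CELL-ARITHMETIC LEAF of (404′):
# ★ F1-COHERENT ROOTS ARE UNCOMPRESSED, and the F1 row floor TRANSPORTS VERBATIM (decomp-a2c hand-1 g57; critic r1914 (A) (H2))

(404′) `…FrustratedLawDichotomyAtlasReachTransport` re-reads (404)'s reach theorem on the transported energy `rootEnergy μ + net F G μ` and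
names, for its simplest admissible kernel — the COMPRESSION PULL `compPull r₁ R a` of the compression mark `Uncompressed r₁` (no atom within
`(0, r₁)` of the root) —, the one place where a certified (228) row floor needs cell arithmetic before it transports: the hypothesis
`h0 : Uncompressed r₁ μ 0` of `floorT_of_floor_uncompressed` / `card_mul_le_net_compPull`.  THIS FILE discharges it for the class-A F1 row of
record `KF1c` (#110 `…CellF1cRow`), with NO kernel decision — the inequality is structural:

* §1 ★ `norm_atom_ge_of_mem_rowF1c`: in a rooted `7/10`-hard-core configuration that is `2⁻¹⁰`-coherent (window `13`) with the strained complete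
  template `posL F ∘ aF1` (`F ∈ BF1`), every atom `p ≠ 0` of the window has `‖p‖ ≥ L − 2⁻¹⁰` for every `L² ≤ (1 − 3·2⁻¹⁰)·(2/5)·2` — because `p`
  lies within `2⁻¹⁰` of a template point `posL F (aF1 m)`, `m ∈ MF1c`; `m = 0` is the root's own tube (excluded by the hard core `7/10 > 2⁻¹⁰`),
  and `m ≠ 0` is a parity label with `|m|² ≥ 2` (tree `two_le_sqT_sub`), hence at distance `≥ L` by the tree's Gershgorin conversion
  `far_of_not_mem_ballF1cc`.  So ★ `voidShell_null_of_mem_rowF1c` / `…_of_mem_KF1c`: the void window `voidShell r₁` is `μ`-null whenever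
  `(r₁ + 2⁻¹⁰)² ≤ (1 − 3·2⁻¹⁰)·(4/5)` (any `r₁ ≤ 0.892`; the dial of record `r₁ = 4/5`, also `89/100`), and ★★ `uncompressed_of_mem_KF1c`:
  EVERY rooted `7/10`-hard-core member of `KF1c` carries the compression mark at its root.
* §2 ★★ `hfloorT_KF1c`: THE F1 ROW FLOOR ON THE TRANSPORTED ENERGY, UNCONDITIONAL — for every `R`, `a` and every such `r₁`, every rooted
  `7/10`-hard-core NASH configuration of `KF1c` has `e⋆ + 23/10⁴ ≤ rootEnergy μ + net 0 (compPull r₁ R a) μ` (#129 `hfloor_KF1c` + (404′)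
  `floorT_of_floor_uncompressed`): the `hfloorT` line of (404′) `coherentMassExclusion_of_floorsT` for the one-row atlas `{F1}`, by name.
* §3 junctions, with ONLY the transported cap `D_T` (K2 of the g117 memo — NOT certified here or anywhere yet) and A(η) as hypotheses:
  `coherentMassExclusion_F1_compPull` — F(η) for `{F1}` at every `η ≤ reach (23/10⁴) D_T` —, and `aperiodicFrustratedLawGap_of_offAtlasMassGap_F1_compPull`
  — the crux ⟸ `hcapT (D_T)` ∧ `OffAtlasMassGap 1 {F1} (reach (23/10⁴) D_T)`; `reach` is antitone in the cap, so any certified `D_T < D_univ` strictly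
  widens #129's unconditional `coherentMassExclusion_F1` (remark `reach_F1_compPull_mono`).
* §4 sanity (non-vacuity): the exact F1 lattice `latticeF1 ∈ KF1c` (#110) is a rooted `7/10`-hard-core configuration with uncompressed root.
HONEST LABELS.  Floors side (i) of (404′)'s HONEST LABELS is CLOSED for the F1 row; the cap side (ii) `D_T` stays INSTRUMENTABLE/K2 and A(η) stays the
residual — this file proves no numeric `D_T` and no reach figure.  Imports TREE (404′) `…AtlasReachTransport` + #129 `…CellF1cCert` only; theorems only
(no def / instance / notation / option); 0 sorry; no `decide`.  Tags: [new: cell arithmetic] §1–§2, [new: junction] §3, [folklore] §4.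
-/

noncomputable section

namespace Summit.AtomisticToContinuum.Crystallization.Theorems.FrustratedLawDichotomyCellF1cUncompressed

open MeasureTheory Metric Set
open scoped ENNReal BigOperators
open Literature.MathematicalPhysics.StatisticalMechanics (lennardJones rootEnergy)
open Literature.Probability.Process (IsRootedHardCore count_restrict_singleton_ne_zero_iff)
open Summit.AtomisticToContinuum.Crystallization.Theorems.ChargedEnergyGapNegative (E3 eStar)
open Summit.AtomisticToContinuum.Crystallization.Theorems.FrustratedLawDichotomySignedLedger (net)
open Summit.AtomisticToContinuum.Crystallization.Theorems.FrustratedLawDichotomyPullKernel (measurable_zero_kernel lintegral_outflow_zero_kernel_le)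
open Summit.AtomisticToContinuum.Crystallization.Theorems.FrustratedLawDichotomyCoherentSets (coherentAt count_restrict_mem_coherentAt_iff')
open Summit.AtomisticToContinuum.Crystallization.Theorems.FrustratedLawDichotomyCellMetric (posL posL_zero)
open Summit.AtomisticToContinuum.Crystallization.Theorems.FrustratedLawDichotomyCellClasses (ballL)
open Summit.AtomisticToContinuum.Crystallization.Theorems.FrustratedLawDichotomyCellTriples (zT sumT mem_ballL_zT two_le_sqT_sub)
open Summit.AtomisticToContinuum.Crystallization.Theorems.FrustratedLawDichotomyCellRows (ratBox_subset)
open Summit.AtomisticToContinuum.Crystallization.Theorems.FrustratedLawDichotomyCellF1Frame (sep_F1)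
open Summit.AtomisticToContinuum.Crystallization.Theorems.FrustratedLawDichotomyCellF1cLabels (MF1c hparc zero_mem_Mc)
open Summit.AtomisticToContinuum.Crystallization.Theorems.FrustratedLawDichotomyCellF1Symm (BF1 mem_BF1)
open Summit.AtomisticToContinuum.Crystallization.Theorems.FrustratedLawDichotomyCellF1Pos (aF1 aF1_root)
open Summit.AtomisticToContinuum.Crystallization.Theorems.FrustratedLawDichotomyCellF1cLists (far_of_not_mem_ballF1cc)
open Summit.AtomisticToContinuum.Crystallization.Theorems.FrustratedLawDichotomyCellF1cRow (KF1c KF1c_subset measurableSet_KF1c latticeF1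
  latticeF1_mem_KF1c one_mem_ratBox_BF1)
open Summit.AtomisticToContinuum.Crystallization.Theorems.FrustratedLawDichotomyCellF1cCert (hfloor_KF1c)
open Summit.AtomisticToContinuum.Crystallization.Theorems.FrustratedLawDichotomyAtlasReach (reach reach_anti Duniv CoherentMassExclusion
  OffAtlasMassGap aperiodicFrustratedLawGap_of_massSplit)
open Summit.AtomisticToContinuum.Crystallization.Theorems.FrustratedLawDichotomyAtlasReachTransport (voidShell measurableSet_voidShell
  Uncompressed uncompressed_zero_iff compPull measurable_compPull exists_outflow_bound_compPull floorT_of_floor_uncompressed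
  coherentMassExclusion_of_floorsT)

/-! ## §1 ★ F1-coherent hard-core roots are uncompressed (structural: parity `|m|² ≥ 2` + Gershgorin `2/5` + box `2⁻¹⁰`) -/

/-- ★ THE GEOMETRIC CORE.  A rooted `7/10`-hard-core configuration that is `2⁻¹⁰`-coherent with window `13` at the strained complete F1 template
`posL F ∘ aF1` for some `F ∈ BF1` has no atom `p ≠ 0` of norm `< L − 2⁻¹⁰` inside the window, for every `L` with `L² ≤ (1 − 3·2⁻¹⁰)·(2/5)·2`:
`p` sits within `2⁻¹⁰` of a template point `posL F (aF1 m)`, `m ∈ MF1c`; the root's own tube `m = 0` is excluded by the hard core, and a label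
`m ≠ 0` has `|m|² ≥ 2` (parity), hence `‖posL F (aF1 m)‖ ≥ L` (`far_of_not_mem_ballF1cc`). [new: cell arithmetic] -/
theorem norm_atom_ge_of_mem_rowF1c {L : ℝ} (hL : L ^ 2 ≤ (1 - 3 * (1 / 1024)) * (2 / 5) * 2) {μ : Measure E3} (hμ : IsRootedHardCore (7 / 10) μ)
    (hrow : μ ∈ ⋃ F ∈ BF1, coherentAt (MF1c.image fun m => posL F (aF1 m)) (1 / 1024) 13) {p : E3} (hp : μ {p} ≠ 0) (hp0 : p ≠ 0)
    (hp13 : ‖p‖ ≤ 13) : L - 1 / 1024 ≤ ‖p‖ := by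
  obtain ⟨S, h0S, hsep, rfl⟩ := hμ
  have hpS : p ∈ S := (count_restrict_singleton_ne_zero_iff S p).1 hp
  have h7 : (7 / 10 : ℝ) ≤ ‖p‖ := by
    have h := hsep p hpS 0 h0S hp0
    rwa [dist_zero_right] at h
  obtain ⟨F, hF, hcoh⟩ := Set.mem_iUnion₂.mp hrow
  have hG := mem_BF1.mp hF
  have hsub := ((count_restrict_mem_coherentAt_iff' S _ (1 / 1024) 13).mp hcoh).2
  have hpw : p ∈ S ∩ closedBall (0 : E3) 13 := ⟨hpS, mem_closedBall.mpr (by rwa [dist_zero_right])⟩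
  obtain ⟨x, hx, hpx⟩ := Set.mem_iUnion₂.mp (hsub hpw)
  obtain ⟨m, hm, rfl⟩ := Finset.mem_image.mp hx
  have hpx' : dist p (posL F (aF1 m)) ≤ 1 / 1024 := by rw [mem_closedBall] at hpx; exact hpx
  by_cases hm0 : m = 0
  · subst hm0
    rw [aF1_root, posL_zero, dist_zero_right] at hpx'
    linarith
  · have hn : m ∉ ballL MF1c zT 2 (0 : ℤ × ℤ × ℤ) := fun h => by
      have h2 := two_le_sqT_sub (hparc m hm) (hparc 0 zero_mem_Mc) hm0
      have h1 := (mem_ballL_zT.mp h).2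
      omega
    have hL' : L ^ 2 ≤ (1 - 3 * (1 / 1024)) * (2 / 5) * ((2 : ℤ) : ℝ) := by push_cast; exact hL
    have hfar : L ≤ ‖posL F (aF1 m)‖ := far_of_not_mem_ballF1cc hG hL' hm hn
    have htri := norm_sub_norm_le (posL F (aF1 m)) p
    rw [← dist_eq_norm, dist_comm] at htri
    linarith

/-- ★ THE VOID WINDOW IS NULL on the real-`F` F1 row: for `(r₁ + 2⁻¹⁰)² ≤ (1 − 3·2⁻¹⁰)·(2/5)·2` (any `r₁ ≤ 0.892`) a rooted `7/10`-hard-core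
configuration coherent with the strained complete F1 template has no atom in `ball 0 r₁ ∖ {0}`. [new: cell arithmetic] -/
theorem voidShell_null_of_mem_rowF1c {r₁ : ℝ} (hr : (r₁ + 1 / 1024) ^ 2 ≤ (1 - 3 * (1 / 1024)) * (2 / 5) * 2) {μ : Measure E3}
    (hμ : IsRootedHardCore (7 / 10) μ) (hrow : μ ∈ ⋃ F ∈ BF1, coherentAt (MF1c.image fun m => posL F (aF1 m)) (1 / 1024) 13) :
    μ (voidShell r₁) = 0 := by
  have hr1 : r₁ + 1 / 1024 ≤ 1 := by nlinarith [hr, sq_nonneg (r₁ + 1 / 1024 - 1)]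
  have hμ' := hμ
  obtain ⟨S, -, -, rfl⟩ := hμ'
  rw [Measure.restrict_apply (measurableSet_voidShell r₁), Measure.count_eq_zero_iff, Set.eq_empty_iff_forall_notMem]
  rintro p ⟨⟨hpb, hp0⟩, hpS⟩
  rw [mem_ball_zero_iff] at hpb
  have hp0' : p ≠ 0 := fun h => hp0 (by rw [h]; exact Set.mem_singleton 0)
  have h := norm_atom_ge_of_mem_rowF1c hr hμ hrow ((count_restrict_singleton_ne_zero_iff S p).2 hpS) hp0' (by linarith)
  linarith

/-- ★ the void window is null on the ROW OF RECORD `KF1c` (rational `F`; `KF1c ⊆` the real-`F` row, #110 `KF1c_subset`). [new: cell arithmetic] -/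
theorem voidShell_null_of_mem_KF1c {r₁ : ℝ} (hr : (r₁ + 1 / 1024) ^ 2 ≤ (1 - 3 * (1 / 1024)) * (2 / 5) * 2) {μ : Measure E3}
    (hμ : IsRootedHardCore (7 / 10) μ) (hK : μ ∈ KF1c) : μ (voidShell r₁) = 0 :=
  voidShell_null_of_mem_rowF1c hr hμ (KF1c_subset hK)

/-- ★★ **F1-COHERENT ROOTS ARE UNCOMPRESSED** (the cell-arithmetic leaf of (404′), general dial): every rooted `7/10`-hard-core member of the
F1 row of record carries the compression mark `Uncompressed r₁` at its root, for every `r₁` with `(r₁ + 2⁻¹⁰)² ≤ (1 − 3·2⁻¹⁰)·(2/5)·2`. [new: cell arithmetic] -/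
theorem uncompressed_of_mem_KF1c {r₁ : ℝ} (hr : (r₁ + 1 / 1024) ^ 2 ≤ (1 - 3 * (1 / 1024)) * (2 / 5) * 2) {μ : Measure E3}
    (hμ : IsRootedHardCore (7 / 10) μ) (hK : μ ∈ KF1c) : Uncompressed r₁ μ 0 :=
  (uncompressed_zero_iff r₁ μ).2 ⟨hμ, voidShell_null_of_mem_KF1c hr hμ hK⟩

/-- ★★ THE DIAL OF RECORD `r₁ = 4/5` (the compression pull `compPull (4/5) (11/10) a` of (404′) §5 / the companion `…Negative.OffAtlasCapCeilingTransport`):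
KF1c roots are `Uncompressed (4/5)`. [new: cell arithmetic] -/
theorem uncompressed_45_of_mem_KF1c {μ : Measure E3} (hμ : IsRootedHardCore (7 / 10) μ) (hK : μ ∈ KF1c) : Uncompressed (4 / 5) μ 0 :=
  uncompressed_of_mem_KF1c (by norm_num) hμ hK

/-- the margin: the same holds up to `r₁ = 89/100` (the strained F1 nearest-neighbour distance is `≥ 0.893`). [new: cell arithmetic] -/
theorem uncompressed_89_of_mem_KF1c {μ : Measure E3} (hμ : IsRootedHardCore (7 / 10) μ) (hK : μ ∈ KF1c) : Uncompressed (89 / 100) μ 0 :=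
  uncompressed_of_mem_KF1c (by norm_num) hμ hK

/-! ## §2 ★★ The F1 row floor on the transported energy, unconditional -/

/-- ★★ **THE F1 TRANSPORTED ROW FLOOR, UNCONDITIONAL** (the `hfloorT` line of (404′) `coherentMassExclusion_of_floorsT` for the row `KF1c`, kernels
`F = 0`, `G = compPull r₁ R a`): every rooted `7/10`-hard-core NASH configuration of `KF1c` has `e⋆ + 23/10⁴ ≤ rootEnergy μ + net 0 (compPull r₁ R a) μ`
— #129 `hfloor_KF1c` transported verbatim through its uncompressed root ((404′) `floorT_of_floor_uncompressed`). [new: cell arithmetic] -/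
theorem hfloorT_KF1c {r₁ : ℝ} (hr : (r₁ + 1 / 1024) ^ 2 ≤ (1 - 3 * (1 / 1024)) * (2 / 5) * 2) (R a : ℝ) :
    ∀ μ : Measure E3, IsRootedHardCore (7 / 10) μ →
      (∀ p : E3, μ {p} ≠ 0 → ∀ w : E3, (∀ q : E3, μ {q} ≠ 0 → q ≠ p → w ≠ q) →
        ∑' q : {q : E3 // μ {q} ≠ 0 ∧ q ≠ p}, lennardJones (dist p (q : E3)) ≤
          ∑' q : {q : E3 // μ {q} ≠ 0 ∧ q ≠ p}, lennardJones (dist w (q : E3))) →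
      μ ∈ KF1c → eStar + 23 / 10000 ≤ rootEnergy lennardJones μ + net 0 (compPull r₁ R a) μ :=
  fun μ hμ hN hK => floorT_of_floor_uncompressed (uncompressed_of_mem_KF1c hr hμ hK) (hfloor_KF1c μ hμ hN hK)

/-- ★★ the transported F1 floor at the dial of record `r₁ = 4/5` (every pull radius `R` and weight `a`). [new: cell arithmetic] -/
theorem hfloorT_KF1c_45 (R a : ℝ) :
    ∀ μ : Measure E3, IsRootedHardCore (7 / 10) μ →
      (∀ p : E3, μ {p} ≠ 0 → ∀ w : E3, (∀ q : E3, μ {q} ≠ 0 → q ≠ p → w ≠ q) →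
        ∑' q : {q : E3 // μ {q} ≠ 0 ∧ q ≠ p}, lennardJones (dist p (q : E3)) ≤
          ∑' q : {q : E3 // μ {q} ≠ 0 ∧ q ≠ p}, lennardJones (dist w (q : E3))) →
      μ ∈ KF1c → eStar + 23 / 10000 ≤ rootEnergy lennardJones μ + net 0 (compPull (4 / 5) R a) μ :=
  hfloorT_KF1c (by norm_num) R a

/-! ## §3 Junctions: the one-row atlas `{F1}` under the compression pull, modulo the transported cap `D_T` only -/

/-- ★ **F(η) FOR `{F1}` UNDER TRANSPORT, MODULO THE TRANSPORTED CAP ONLY**: a transported deficit cap `e⋆ − rootEnergy μ − net 0 (compPull r₁ R a) μ ≤ D`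
on rooted `7/10`-hard-core configurations (K2 — hypothesis) proves `CoherentMassExclusion 1 {KF1c} η` for every `η ≤ reach (23/10⁴) D`; the floor side
is §2, the door clauses of (325) are (329)/(404′) by name (`measurable_zero_kernel`, `measurable_compPull`, `exists_outflow_bound_compPull`). [new: junction] -/
theorem coherentMassExclusion_F1_compPull {r₁ : ℝ} (hr : (r₁ + 1 / 1024) ^ 2 ≤ (1 - 3 * (1 / 1024)) * (2 / 5) * 2) (R a : ℝ) {D : ℝ}
    (hD : 0 ≤ D) (hcapT : ∀ μ : Measure E3, IsRootedHardCore (7 / 10) μ → eStar - rootEnergy lennardJones μ - net 0 (compPull r₁ R a) μ ≤ D)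
    {η : ℝ} (hη : η ≤ reach (23 / 10000) D) : CoherentMassExclusion 1 (fun _ => KF1c) η := by
  obtain ⟨B, hB, hBb⟩ := exists_outflow_bound_compPull r₁ R a
  exact coherentMassExclusion_of_floorsT 1 (fun _ => KF1c) (fun _ => measurableSet_KF1c) (fun _ => 23 / 10000) 0 (compPull r₁ R a)
    measurable_zero_kernel (measurable_compPull r₁ R a) ENNReal.zero_ne_top hB (fun μ _ => lintegral_outflow_zero_kernel_le μ 0) hBb
    (fun _ _ μ hμ hN hK => hfloorT_KF1c hr R a μ hμ hN hK) (by norm_num) hD (fun _ _ => le_rfl) hcapT hη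

/-- ★ **THE CRUX ⟸ `D_T` ∧ A(reach)** for the one-row atlas `{F1}` under the compression pull: a transported cap `D` and the off-`{F1}` residual
`OffAtlasMassGap 1 {KF1c} (reach (23/10⁴) D)` prove `AperiodicFrustratedLawGap` ((404) `aperiodicFrustratedLawGap_of_massSplit`). [new: junction] -/
theorem aperiodicFrustratedLawGap_of_offAtlasMassGap_F1_compPull {r₁ : ℝ} (hr : (r₁ + 1 / 1024) ^ 2 ≤ (1 - 3 * (1 / 1024)) * (2 / 5) * 2)
    (R a : ℝ) {D : ℝ} (hD : 0 ≤ D)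
    (hcapT : ∀ μ : Measure E3, IsRootedHardCore (7 / 10) μ → eStar - rootEnergy lennardJones μ - net 0 (compPull r₁ R a) μ ≤ D)
    (hA : OffAtlasMassGap 1 (fun _ => KF1c) (reach (23 / 10000) D)) :
    Summit.AtomisticToContinuum.Crystallization.Theses.FrustratedLawDichotomy.AperiodicFrustratedLawGap :=
  aperiodicFrustratedLawGap_of_massSplit 1 (fun _ => KF1c) _ (coherentMassExclusion_F1_compPull hr R a hD hcapT le_rfl) hA

/-- Remark (what a transported cap buys): `reach` is antitone in the cap, so any certified `D_T ≤ D_univ` for the compression pull gives F(η) for `{F1}` at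
`η = reach (23/10⁴) D_univ` AND BEYOND (up to `reach (23/10⁴) D_T`) — #129's unconditional `coherentMassExclusion_F1` is the case `D_T = D_univ`
of no income. [new: bookkeeping] -/
theorem reach_F1_compPull_mono {r₁ : ℝ} (hr : (r₁ + 1 / 1024) ^ 2 ≤ (1 - 3 * (1 / 1024)) * (2 / 5) * 2) (R a : ℝ) {D : ℝ} (hD : 0 ≤ D)
    (hDu : D ≤ Duniv) (hcapT : ∀ μ : Measure E3, IsRootedHardCore (7 / 10) μ → eStar - rootEnergy lennardJones μ - net 0 (compPull r₁ R a) μ ≤ D) :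
    reach (23 / 10000) Duniv ≤ reach (23 / 10000) D ∧ CoherentMassExclusion 1 (fun _ => KF1c) (reach (23 / 10000) D) :=
  ⟨reach_anti (by norm_num) hD hDu, coherentMassExclusion_F1_compPull hr R a hD hcapT le_rfl⟩

/-! ## §4 Sanity: the row's inhabitant of record has an uncompressed root -/

/-- The exact F1 lattice (#110 `latticeF1`, the inhabitation witness of `KF1c`) is a rooted `7/10`-hard-core configuration (parity labels are
`7/10`-separated under the identity strain, tree `sep_F1`). [folklore] -/
theorem isRootedHardCore_latticeF1 : IsRootedHardCore (7 / 10) latticeF1 := by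
  have hG := mem_BF1.mp (ratBox_subset BF1 one_mem_ratBox_BF1)
  refine ⟨(fun z : ℤ × ℤ × ℤ => posL 1 (aF1 z)) '' {z | Even (sumT z)}, ⟨0, hparc 0 zero_mem_Mc, ?_⟩, ?_, rfl⟩
  · show posL 1 (aF1 0) = 0
    rw [aF1_root, posL_zero]
  rintro x ⟨z, hz, rfl⟩ y ⟨z', hz', rfl⟩ hne
  have hzz : z ≠ z' := fun h => hne (by rw [h])
  exact sep_F1 hG hz hz' hzz

/-- ★ sanity / non-vacuity: the inhabitant of record of `KF1c` has an UNCOMPRESSED root at the dial `4/5` (§1 applied to #110 `latticeF1_mem_KF1c`).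
[folklore] -/
theorem uncompressed_latticeF1 : Uncompressed (4 / 5) latticeF1 0 := uncompressed_45_of_mem_KF1c isRootedHardCore_latticeF1 latticeF1_mem_KF1c

end Summit.AtomisticToContinuum.Crystallization.Theorems.FrustratedLawDichotomyCellF1cUncompressed

end
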